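import Literature.MathematicalPhysics.QuantumFieldTheory.BalabanImbrieJaffe1984to88.BIJ88Ineq5144EndChainCT
import Literature.MathematicalPhysics.QuantumFieldTheory.BalabanImbrieJaffe1984to88.BIJ88GaussShellLocalDrift309
import Literature.MathematicalPhysics.QuantumFieldTheory.BalabanImbrieJaffe1984to88.BIJ88GaussShellSum309

/-!
# `BalabanImbrieJaffe1984to88.BIJ88SlotDriftLetter309` — T. Bałaban, J. Imbrie, A. Jaffe, *Effective action and cluster properties of the
abelian Higgs model*, Commun. Math. Phys. **114** (1988) 257–315 [BalabanImbrieJaffe1988]: p. 305 [PDF 49] (*"an exponentially decaying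
covariance C_s"*), p. 307 [PDF 51] L4 (*"factors ℱ = O(e^{−cr(e_k)})"*) and L5–13, verbatim: *"Functional derivatives hitting χ-factors farther
than ½r(e_k) from Λ₁₀^{(k)c} produce factors e^{−cp(e_k)²} after integrating with respect to A^{(k)″}, φ^{(k)″}. … (here we use the fact that the
translation vanishes). … Functional derivatives hitting χ′-factors within ½r(e_k) of Λ₁₀^{(k)c} are connected through C_ω(α) to Λ₁₁^{(k)}, so we
get small factors e^{−cr(e_k)} from the exponential decay of the operators C_s and Δ in C_ω(α)"* — **THE DRIFT SEEN BY ONE SLOT FIELD IS LOCAL: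
A SIZE-FREE BOUND FROM THE DECAY OF `(Δ_s)⁻¹` AND A SITEWISE SOURCE**.

Road (α) of the owner's pre-filing review (ROWS-C2-part2 v2.386) of the size-free located (5.14.4): the Gaussian shells of the master bound carry
the drift `ΛF/m` with `F` the TOTAL ℓ²-mass of the source on the region — not uniform in the number of cubes.  The drift that the shell of slot
`b` actually sees is the mean `Φ_b(ext((Δ_s|_X)⁻¹ℱ|_X))` (`BIJ88GaussShellLocalDrift309`), and this is bounded UNIFORMLY IN `|X|`:
`|((Δ_s|_X)⁻¹ℱ|_X)(x)| ≤ Σ_y |(Δ_s|_X)⁻¹(x,y)|·|ℱ(y)| ≤ (2/m)·F₀·Z` by the site-level Combes–Thomas decay `|(Δ_s|_X)⁻¹(x,y)| ≤ (2/m)e^{−μd(x,y)}`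
(`BIJ88Ineq5144EndChainCT.restricted_inv_decay`, from the `Δ`-letters: a site pseudometric `d` with `Δ` banded at range 1, off-diagonal size
`h`, local volume `z`, coercivity `m`, and the smallness `hz(e^μ − 1) ≤ m/2`), a sitewise source bound `|ℱ(y)| ≤ F₀` on the sites of `X` and the
site lattice sum `Σ_y e^{−(μ/2)d(x,y)} ≤ Z`; with an ℓ^∞ letter `|Φ_b φ| ≤ Λ_∞·max|φ|` for the slot functional (block averages: `Λ_∞ = 1`) the
drift is `≤ Λ_∞(2/m)F₀Z` for every slot, every region `X`, every `s ∈ [0,1]^I`: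
* `abs_prec_inv_le_exp` — the decay of the located interpolated inverse (model wrapper of `restricted_inv_decay`);
* `abs_ext_prec_inv_mulVec_src_le` — `|ext((prec)⁻¹ src)(x)| ≤ (2/m)F₀Z`;
* `abs_slotField_drift_le` — `|Φ_b(ext((prec)⁻¹ src))| ≤ Λ_∞(2/m)F₀Z`;
* **`abs_gexp_prec_le_shell_sizeFree`** — the shell bound of `BIJ88GaussShellLocalDrift309.abs_gexp_prec_le_shell_local` for the coupled
  interpolated covariance `Δ_{1_{Λ^c}}` with this drift: `|⟨G⟩_{s,X}| ≤ M·Π_b 2e^{−a_b(a_b − 2Λ_∞(2/m)F₀Z)/(2Λ²/m)}` — no `‖ℱ|_X‖₂`;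
* `abs_gexp_prec_le_sum_shell_local`, **`abs_gexp_prec_le_sum_shell_sizeFree`** — the same for a factor bounded by a SUM of shell indicators over
  the hit slots of each term (`BIJ88GaussShellSum309.abs_gexp_prec_le_sum_shell` with per-slot drifts, resp. with the size-free drift) — the
  form in which the shells enter `BIJ88TermShellBound309` / `BIJ88TermHitShellBound309` and the master bound `BIJ88LocatedActivityBound309`.

statement-level skeleton of published theorems with citation tags; proofs where landed; nothing here is a claim about the Yang–Mills mass gap

PDF held: `paper:balaban1988-cmp114-bij-abelian-higgs-effective-action` pp. 305, 307 (p0049, p0051 L4–13) re-read this session as text.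

CITATION HEADER (lean-in-tree rule).  Part of the lit-balaban TYPED SKELETON (HOME `run/shared/lean/pub/lit-balaban/`), Phase 2, seat p36
(gen 23, unit `lit-balaban-p36`); rows **C2.Eq5.14.3-5.14.4** (member: road (α), the size-free drift letter) and C2.Eq5.13.3-5.13.4 (member) of
`HOME/lit-balaban-r16/ROWS-C2-part2.md` (owner r16, referee ref-5).  Theorem-only; no definitions, no `Prop` facts; axioms standard.
HONEST SCOPE: the `Δ`-letters, `F₀`, `Z`, `Λ_∞` are inputs (hypotheses); the re-threading of the master bound's shells through
`abs_gexp_prec_le_shell_sizeFree` (dropping `‖ℱ|_X‖₂ ≤ F`) is not done here.  NOT summit progress; NOT continuum; NOT Clay.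

REVISION v1.1 (doc-only, owner item D-owner-v2.389): the p. 307 L5–13 quotation above now carries print's region symbols `Λ₁₀^{(k)c}`,
`Λ₁₁^{(k)}` and *"χ′-factors"*; no declaration changed.
-/

namespace Literature.MathematicalPhysics.QuantumFieldTheory.BalabanImbrieJaffe1984to88.BIJ88SlotDriftLetter309

open Finset Matrix
open scoped BigOperators
open Literature.MathematicalPhysics.QuantumFieldTheory.Balaban1983to89
open B2Eq228Conditioning (In blkIn)
open BIJ88TruncationConnected306 (gexp)
open BIJ88DirichletForms305 (interpForm interpForm_posDef quadForm_interpForm_ge)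
open BIJ88PolymerRep5134 (corner)
open BIJ88PolymerRep5134Gauss (ext prec src)
open BIJ88PolymerRep5134GaussWitness (corner_mem_cube)
open BIJ88Ineq5144EndChainCT (restricted_inv_decay)
open BIJ88GaussShellInterpolated309 (prec_posDef_of_mem_cube dotProduct_prec_mulVec_ge_of_mem_cube)
open BIJ88GaussShellLocalDrift309 (shift_real_forall_abs_ge_le_local abs_gexp_prec_le_shell_local)
open BIJ88GaussShellSum309 (abs_gexp_le_sum_of_indicator frame_restrict)
open BIJ88SlotFieldGaussBounds (ext_dotProduct_ext)

variable {α I : Type} [Fintype α] [DecidableEq α] [Fintype I] [DecidableEq I] (blk : α → I) (Δ : Matrix α α ℝ) (ℱ : α → ℝ)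

/-! ## §1  The decay of the located interpolated inverse -/

/-- **DECAY OF THE RESTRICTED INTERPOLATED INVERSE** (p. 305: *"an exponentially decaying covariance C_s"*): under the `Δ`-letters,
`|(prec blk Δ_{1_{Λ^c}} X s)⁻¹(y,x)| ≤ (2/m)·e^{−μ·d(y,x)}` for every region `X` and every `s ∈ [0,1]^I` (`BIJ88Ineq5144EndChainCT.restricted_inv_decay`
on the sites of `X`). [cite: BalabanImbrieJaffe1988, §5.13 p.305] -/
theorem abs_prec_inv_le_exp (d : α → α → ℝ) (hd0 : ∀ i, d i i = 0) (hdsymm : ∀ i k, d i k = d k i)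
    (hdtri : ∀ i j k, d i k ≤ d i j + d j k) (hband : ∀ x y, 1 < d x y → Δ x y = 0) {h : ℝ} (hh0 : 0 ≤ h)
    (hh : ∀ x y, x ≠ y → |Δ x y| ≤ h) {z : ℝ} (hz : ∀ x, ((univ.filter fun y => y ≠ x ∧ d x y ≤ 1).card : ℝ) ≤ z)
    (hΔ : Δ.PosDef) {m : ℝ} (hm : 0 < m) (hΔm : ∀ φ : α → ℝ, m * (φ ⬝ᵥ φ) ≤ φ ⬝ᵥ (Δ *ᵥ φ)) {μ : ℝ} (hμ : 0 ≤ μ)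
    (hsmall : h * z * (Real.exp μ - 1) ≤ m / 2) (Λc X : Finset I) {s : I → ℝ} (hs : ∀ i, 0 ≤ s i ∧ s i ≤ 1)
    (y x : BIJ88PolymerRep5134Gauss.Site blk X) :
    |(prec blk (interpForm blk Δ (corner ℝ Λc)) X s)⁻¹ y x| ≤ 2 / m * Real.exp (-(μ * d y.1 x.1)) := by
  have h1 := restricted_inv_decay (blk := blk) (Δ := Δ) d hd0 hdsymm hdtri hband hh0 hh hz hΔ hm hΔm hμ hsmall Λc hs
    (fun x => blk x ∈ X) y x
  simpa [blkIn, prec] using h1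

/-! ## §2  The translation seen at a site, and by a slot field -/

/-- **THE TRANSLATION IS LOCALLY BOUNDED, UNIFORMLY IN THE REGION**: `|ext((prec)⁻¹ src)(x)| ≤ (2/m)·F₀·Z` for every site `x`, from the
decay of `(prec)⁻¹`, the sitewise source bound `|ℱ(y)| ≤ F₀` on the sites of `X` and the site lattice sum `Σ_y e^{−(μ/2)d(x,y)} ≤ Z`
(p. 307 L4: *"factors ℱ = O(e^{−cr(e_k)})"*; L12–13: *"the exponential decay of the operators C_s and Δ"*).
[cite: BalabanImbrieJaffe1988, §5.13 p.307 L4–13] -/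
theorem abs_ext_prec_inv_mulVec_src_le (d : α → α → ℝ) (hd0 : ∀ i, d i i = 0) (hdsymm : ∀ i k, d i k = d k i)
    (hdtri : ∀ i j k, d i k ≤ d i j + d j k) (hband : ∀ x y, 1 < d x y → Δ x y = 0) {h : ℝ} (hh0 : 0 ≤ h)
    (hh : ∀ x y, x ≠ y → |Δ x y| ≤ h) {z : ℝ} (hz : ∀ x, ((univ.filter fun y => y ≠ x ∧ d x y ≤ 1).card : ℝ) ≤ z)
    (hΔ : Δ.PosDef) {m : ℝ} (hm : 0 < m) (hΔm : ∀ φ : α → ℝ, m * (φ ⬝ᵥ φ) ≤ φ ⬝ᵥ (Δ *ᵥ φ)) {μ : ℝ} (hμ : 0 ≤ μ)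
    (hsmall : h * z * (Real.exp μ - 1) ≤ m / 2) (Λc X : Finset I) {s : I → ℝ} (hs : ∀ i, 0 ≤ s i ∧ s i ≤ 1)
    {F₀ : ℝ} (hF₀ : 0 ≤ F₀) (hℱ : ∀ y : BIJ88PolymerRep5134Gauss.Site blk X, |ℱ y.1| ≤ F₀) {Z : ℝ} (hZ0 : 0 ≤ Z)
    (hZ : ∀ y' : BIJ88PolymerRep5134Gauss.Site blk X, ∑ y : BIJ88PolymerRep5134Gauss.Site blk X, Real.exp (-(μ / 2 * d y'.1 y.1)) ≤ Z)
    (x : α) :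
    |ext blk X ((prec blk (interpForm blk Δ (corner ℝ Λc)) X s)⁻¹ *ᵥ src blk ℱ X) x| ≤ 2 / m * F₀ * Z := by
  unfold BIJ88PolymerRep5134Gauss.ext
  split_ifs with hx
  · rw [mulVec, dotProduct]
    refine (abs_sum_le_sum_abs _ _).trans ?_
    have hdnn : ∀ y : α, 0 ≤ d x y := fun y => by
      have h1 := hdtri x y x
      rw [hd0, hdsymm y x] at h1
      linarith
    calc ∑ y : BIJ88PolymerRep5134Gauss.Site blk X, |(prec blk (interpForm blk Δ (corner ℝ Λc)) X s)⁻¹ ⟨x, hx⟩ y * src blk ℱ X y|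
        ≤ ∑ y : BIJ88PolymerRep5134Gauss.Site blk X, 2 / m * Real.exp (-(μ / 2 * d x y.1)) * F₀ := by
          refine sum_le_sum fun y _ => ?_
          rw [abs_mul]
          refine mul_le_mul ((abs_prec_inv_le_exp blk Δ d hd0 hdsymm hdtri hband hh0 hh hz hΔ hm hΔm hμ hsmall Λc X hs ⟨x, hx⟩ y).trans
            (mul_le_mul_of_nonneg_left (Real.exp_le_exp.2 (by nlinarith [hdnn y.1])) (div_nonneg (by norm_num) hm.le)))
            (hℱ y) (abs_nonneg _) (mul_nonneg (div_nonneg (by norm_num) hm.le) (Real.exp_pos _).le)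
      _ = 2 / m * F₀ * ∑ y : BIJ88PolymerRep5134Gauss.Site blk X, Real.exp (-(μ / 2 * d x y.1)) := by
          rw [mul_sum]
          exact sum_congr rfl fun y _ => by ring
      _ ≤ 2 / m * F₀ * Z := mul_le_mul_of_nonneg_left (hZ ⟨x, hx⟩) (mul_nonneg (div_nonneg (by norm_num) hm.le) hF₀)
  · rw [abs_zero]
    exact mul_nonneg (mul_nonneg (div_nonneg (by norm_num) hm.le) hF₀) hZ0

/-- **THE DRIFT SEEN BY A SLOT FIELD IS SIZE-FREE**: with the ℓ^∞ letter `|Φ_b φ| ≤ Λ_∞·M` whenever `|φ| ≤ M` pointwise (block averages: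
`Λ_∞ = 1`), `|Φ_b(ext((prec)⁻¹ src))| ≤ Λ_∞·(2/m)·F₀·Z` — for every region `X` and every `s`. [cite: BalabanImbrieJaffe1988, §5.13 p.307 L5–13] -/
theorem abs_slotField_drift_le (d : α → α → ℝ) (hd0 : ∀ i, d i i = 0) (hdsymm : ∀ i k, d i k = d k i)
    (hdtri : ∀ i j k, d i k ≤ d i j + d j k) (hband : ∀ x y, 1 < d x y → Δ x y = 0) {h : ℝ} (hh0 : 0 ≤ h)
    (hh : ∀ x y, x ≠ y → |Δ x y| ≤ h) {z : ℝ} (hz : ∀ x, ((univ.filter fun y => y ≠ x ∧ d x y ≤ 1).card : ℝ) ≤ z)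
    (hΔ : Δ.PosDef) {m : ℝ} (hm : 0 < m) (hΔm : ∀ φ : α → ℝ, m * (φ ⬝ᵥ φ) ≤ φ ⬝ᵥ (Δ *ᵥ φ)) {μ : ℝ} (hμ : 0 ≤ μ)
    (hsmall : h * z * (Real.exp μ - 1) ≤ m / 2) (Λc X : Finset I) {s : I → ℝ} (hs : ∀ i, 0 ≤ s i ∧ s i ≤ 1)
    {F₀ : ℝ} (hF₀ : 0 ≤ F₀) (hℱ : ∀ y : BIJ88PolymerRep5134Gauss.Site blk X, |ℱ y.1| ≤ F₀) {Z : ℝ} (hZ0 : 0 ≤ Z)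
    (hZ : ∀ y' : BIJ88PolymerRep5134Gauss.Site blk X, ∑ y : BIJ88PolymerRep5134Gauss.Site blk X, Real.exp (-(μ / 2 * d y'.1 y.1)) ≤ Z)
    {Φb : (α → ℝ) → ℝ} {Λinf : ℝ} (hΦinf : ∀ (φ : α → ℝ) (M : ℝ), 0 ≤ M → (∀ x, |φ x| ≤ M) → |Φb φ| ≤ Λinf * M) :
    |Φb (ext blk X ((prec blk (interpForm blk Δ (corner ℝ Λc)) X s)⁻¹ *ᵥ src blk ℱ X))| ≤ Λinf * (2 / m * F₀ * Z) :=
  hΦinf _ _ (mul_nonneg (mul_nonneg (div_nonneg (by norm_num) hm.le) hF₀) hZ0)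
    (abs_ext_prec_inv_mulVec_src_le blk Δ ℱ d hd0 hdsymm hdtri hband hh0 hh hz hΔ hm hΔm hμ hsmall Λc X hs hF₀ hℱ hZ0 hZ)

/-! ## §3  The size-free shell bound for `⟨·⟩_{s,X}` with the coupled interpolated covariance -/

/-- **THE SHELL FACTORS WITHOUT `‖ℱ|_X‖₂`**: for `⟨·⟩_{s,X}` with precision `prec blk Δ_{1_{Λ^c}} X s` (`Δ ≻ 0`, `Δ ≥ m`, `s ∈ [0,1]^I`), linear slot
fields `Φ_b` (`b ∈ B′`) with the frame letter `Λ` and the ℓ^∞ letter `Λ_∞` (`Λinf`), the `Δ`-letters, a sitewise source `|ℱ| ≤ F₀` on the sites of `X` and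
the site lattice sum `Z`: a factor with `|G| ≤ M·1{a_b ≤ |Φ_b(ext ω)| ∀ b}` has
`|⟨G⟩_{s,X}| ≤ M·Π_b 2e^{−a_b(a_b − 2Λ_∞(2/m)F₀Z)/(2Λ²/m)}` — uniformly in `|X|`. [cite: BalabanImbrieJaffe1988, §5.13 p.307 L5–13, (5.14.4) p.309] -/
theorem abs_gexp_prec_le_shell_sizeFree {ι : Type} [DecidableEq ι] {B' : Finset ι} {Φ : ι → (α → ℝ) → ℝ}
    (d : α → α → ℝ) (hd0 : ∀ i, d i i = 0) (hdsymm : ∀ i k, d i k = d k i)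
    (hdtri : ∀ i j k, d i k ≤ d i j + d j k) (hband : ∀ x y, 1 < d x y → Δ x y = 0) {h : ℝ} (hh0 : 0 ≤ h)
    (hh : ∀ x y, x ≠ y → |Δ x y| ≤ h) {z : ℝ} (hz : ∀ x, ((univ.filter fun y => y ≠ x ∧ d x y ≤ 1).card : ℝ) ≤ z)
    (hΔ : Δ.PosDef) {m : ℝ} (hm : 0 < m) (hΔm : ∀ φ : α → ℝ, m * (φ ⬝ᵥ φ) ≤ φ ⬝ᵥ (Δ *ᵥ φ)) {μ : ℝ} (hμ : 0 ≤ μ)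
    (hsmall : h * z * (Real.exp μ - 1) ≤ m / 2) (Λc X : Finset I) {s : I → ℝ} (hs : ∀ i, 0 ≤ s i ∧ s i ≤ 1)
    {F₀ : ℝ} (hF₀ : 0 ≤ F₀) (hℱ : ∀ y : BIJ88PolymerRep5134Gauss.Site blk X, |ℱ y.1| ≤ F₀) {Z : ℝ} (hZ0 : 0 ≤ Z)
    (hZ : ∀ y' : BIJ88PolymerRep5134Gauss.Site blk X, ∑ y : BIJ88PolymerRep5134Gauss.Site blk X, Real.exp (-(μ / 2 * d y'.1 y.1)) ≤ Z)
    (hlin : ∀ b ∈ B', IsLinearMap ℝ (Φ b)) {Λ : ℝ} (hΛ : 0 < Λ)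
    (hframe : ∀ (θ : ↥B' → ℝ) (φ : α → ℝ), |∑ b : ↥B', θ b * Φ b φ| ≤ Λ * Real.sqrt (∑ b : ↥B', θ b ^ 2) * Real.sqrt (φ ⬝ᵥ φ))
    {Λinf : ℝ} (hΦinf : ∀ b : ↥B', ∀ (φ : α → ℝ) (M : ℝ), 0 ≤ M → (∀ x, |φ x| ≤ M) → |Φ b φ| ≤ Λinf * M)
    {a : ↥B' → ℝ} (ha : ∀ b, 0 ≤ a b) {G : (BIJ88PolymerRep5134Gauss.Site blk X → ℝ) → ℝ} {M : ℝ} (hM : 0 ≤ M)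
    (hG : ∀ ω, |G ω| ≤ M * {ω : BIJ88PolymerRep5134Gauss.Site blk X → ℝ | ∀ b : ↥B', a b ≤ |Φ b (ext blk X ω)|}.indicator 1 ω) :
    |gexp (prec blk (interpForm blk Δ (corner ℝ Λc)) X s) (src blk ℱ X) G| ≤
      M * ∏ b : ↥B', 2 * Real.exp (-(a b * (a b - 2 * (Λinf * (2 / m * F₀ * Z))) / (2 * (Λ ^ 2 / m)))) := by
  have hcs := corner_mem_cube (I := I) Λc
  exact abs_gexp_prec_le_shell_local blk (interpForm blk Δ (corner ℝ Λc)) ℱ (interpForm_posDef blk hΔ hcs) hm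
    (quadForm_interpForm_ge blk hΔm hcs) hs X hlin hΛ hframe (D := fun _ => Λinf * (2 / m * F₀ * Z))
    (fun b => abs_slotField_drift_le blk Δ ℱ d hd0 hdsymm hdtri hband hh0 hh hz hΔ hm hΔm hμ hsmall Λc X hs hF₀ hℱ hZ0 hZ (hΦinf b))
    ha hM hG

/-! ## §4  A factor bounded by a sum of shell indicators (the form used by the term bounds) -/

/-- **`|⟨G⟩_{s,X}| ≤ Σ_t M_t·Π_{b ∈ hit t} 2e^{−a_b(a_b − 2D_b)/(2Λ²/m)}`, PER-SLOT DRIFTS** — `BIJ88GaussShellSum309.abs_gexp_prec_le_sum_shell` with the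
drift letter `|Φ_b(ext((prec blk Δ X s)⁻¹ (src blk ℱ X)))| ≤ D_b` in place of `ΛF/m`. [cite: BalabanImbrieJaffe1988, §5.13 p.307 L5–13, (5.14.4) p.309] -/
theorem abs_gexp_prec_le_sum_shell_local {ι : Type} [DecidableEq ι] {B₀ : Finset ι} {Φ : ι → (α → ℝ) → ℝ} (hΔ : Δ.PosDef) {m : ℝ}
    (hm : 0 < m) (hΔm : ∀ φ : α → ℝ, m * (φ ⬝ᵥ φ) ≤ φ ⬝ᵥ (Δ *ᵥ φ)) {s : I → ℝ} (hs : ∀ i, 0 ≤ s i ∧ s i ≤ 1) (X : Finset I)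
    (hlin : ∀ b ∈ B₀, IsLinearMap ℝ (Φ b)) {Λ : ℝ} (hΛ : 0 < Λ)
    (hframe : ∀ (θ : ↥B₀ → ℝ) (φ : α → ℝ), |∑ b : ↥B₀, θ b * Φ b φ| ≤ Λ * Real.sqrt (∑ b : ↥B₀, θ b ^ 2) * Real.sqrt (φ ⬝ᵥ φ))
    {Dr : ↥B₀ → ℝ} (hD : ∀ b : ↥B₀, |Φ b (ext blk X ((prec blk Δ X s)⁻¹ *ᵥ src blk ℱ X))| ≤ Dr b) {a : ↥B₀ → ℝ} (ha : ∀ b, 0 ≤ a b)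
    {η : Type} (T : Finset η) (hit : η → Finset ↥B₀) {M : η → ℝ} (hM : ∀ t ∈ T, 0 ≤ M t)
    {G : (BIJ88PolymerRep5134Gauss.Site blk X → ℝ) → ℝ}
    (hG : ∀ ω, |G ω| ≤ ∑ t ∈ T, M t *
      {ω : BIJ88PolymerRep5134Gauss.Site blk X → ℝ | ∀ b ∈ hit t, a b ≤ |Φ b (ext blk X ω)|}.indicator 1 ω) :
    |gexp (prec blk Δ X s) (src blk ℱ X) G| ≤
      ∑ t ∈ T, M t * ∏ b ∈ hit t, 2 * Real.exp (-(a b * (a b - 2 * Dr b) / (2 * (Λ ^ 2 / m)))) := by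
  have hℓ : ∀ b : ↥B₀, IsLinearMap ℝ fun ω : BIJ88PolymerRep5134Gauss.Site blk X → ℝ => Φ b (ext blk X ω) := fun b =>
    ⟨fun ω ω' => by rw [(BIJ88EffectiveActionGauss308.isLinearMap_ext blk X).map_add, (hlin b b.2).map_add],
      fun r ω => by rw [(BIJ88EffectiveActionGauss308.isLinearMap_ext blk X).map_smul, (hlin b b.2).map_smul]⟩
  have hframe' : ∀ (θ : ↥B₀ → ℝ) (ω : BIJ88PolymerRep5134Gauss.Site blk X → ℝ),
      |∑ b : ↥B₀, θ b * Φ b (ext blk X ω)| ≤ Λ * Real.sqrt (∑ b : ↥B₀, θ b ^ 2) * Real.sqrt (ω ⬝ᵥ ω) := fun θ ω => by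
    rw [← ext_dotProduct_ext blk X ω ω]
    exact hframe θ (ext blk X ω)
  have hcont : ∀ b : ↥B₀, Continuous fun ω : BIJ88PolymerRep5134Gauss.Site blk X → ℝ => Φ b (ext blk X ω) := fun b =>
    ((hℓ b).mk' _).continuous_of_finiteDimensional
  have hS : ∀ t ∈ T, MeasurableSet {ω : BIJ88PolymerRep5134Gauss.Site blk X → ℝ | ∀ b ∈ hit t, a b ≤ |Φ b (ext blk X ω)|} := by
    intro t _
    have h1 : {ω : BIJ88PolymerRep5134Gauss.Site blk X → ℝ | ∀ b ∈ hit t, a b ≤ |Φ b (ext blk X ω)|} =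
        ⋂ b ∈ hit t, {ω | a b ≤ |Φ b (ext blk X ω)|} := by
      ext ω
      simp only [Set.mem_setOf_eq, Set.mem_iInter]
    rw [h1]
    exact MeasurableSet.biInter (hit t).countable_toSet fun b _ =>
      measurableSet_le measurable_const (continuous_abs.measurable.comp (hcont b).measurable)
  refine (abs_gexp_le_sum_of_indicator (prec_posDef_of_mem_cube blk Δ hΔ hs X) (src blk ℱ X) T hS hG).trans
    (sum_le_sum fun t ht => mul_le_mul_of_nonneg_left ?_ (hM t ht))
  have hev : {ω : BIJ88PolymerRep5134Gauss.Site blk X → ℝ | ∀ b ∈ hit t, a b ≤ |Φ b (ext blk X ω)|} =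
      {ω | ∀ k : ↥(hit t), a k.1 ≤ |Φ k.1 (ext blk X ω)|} := by
    ext ω
    simp only [Set.mem_setOf_eq, Subtype.forall]
  rw [hev, ← prod_coe_sort (hit t)]
  exact shift_real_forall_abs_ge_le_local (prec_posDef_of_mem_cube blk Δ hΔ hs X) hm (dotProduct_prec_mulVec_ge_of_mem_cube blk Δ hΔm hs X)
    (src blk ℱ X) (ℓ := fun (k : ↥(hit t)) ω => Φ k.1 (ext blk X ω)) (fun k => hℓ k.1) hΛ
    (fun θ ω => frame_restrict hframe' (hit t) θ ω) (D := fun k : ↥(hit t) => Dr k.1) (fun k => hD k.1) (a := fun k : ↥(hit t) => a k.1)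
    fun k => ha k.1

/-- **THE SUM-OF-SHELLS BOUND WITHOUT `‖ℱ|_X‖₂`** for the coupled interpolated covariance `Δ_{1_{Λ^c}}`: as `abs_gexp_prec_le_sum_shell_local` with
the size-free drift `Λ_∞(2/m)F₀Z` of §2 at every slot — uniformly in `|X|`. [cite: BalabanImbrieJaffe1988, §5.13 p.307 L4–13, (5.14.4) p.309] -/
theorem abs_gexp_prec_le_sum_shell_sizeFree {ι : Type} [DecidableEq ι] {B₀ : Finset ι} {Φ : ι → (α → ℝ) → ℝ}
    (d : α → α → ℝ) (hd0 : ∀ i, d i i = 0) (hdsymm : ∀ i k, d i k = d k i)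
    (hdtri : ∀ i j k, d i k ≤ d i j + d j k) (hband : ∀ x y, 1 < d x y → Δ x y = 0) {h : ℝ} (hh0 : 0 ≤ h)
    (hh : ∀ x y, x ≠ y → |Δ x y| ≤ h) {z : ℝ} (hz : ∀ x, ((univ.filter fun y => y ≠ x ∧ d x y ≤ 1).card : ℝ) ≤ z)
    (hΔ : Δ.PosDef) {m : ℝ} (hm : 0 < m) (hΔm : ∀ φ : α → ℝ, m * (φ ⬝ᵥ φ) ≤ φ ⬝ᵥ (Δ *ᵥ φ)) {μ : ℝ} (hμ : 0 ≤ μ)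
    (hsmall : h * z * (Real.exp μ - 1) ≤ m / 2) (Λc X : Finset I) {s : I → ℝ} (hs : ∀ i, 0 ≤ s i ∧ s i ≤ 1)
    {F₀ : ℝ} (hF₀ : 0 ≤ F₀) (hℱ : ∀ y : BIJ88PolymerRep5134Gauss.Site blk X, |ℱ y.1| ≤ F₀) {Z : ℝ} (hZ0 : 0 ≤ Z)
    (hZ : ∀ y' : BIJ88PolymerRep5134Gauss.Site blk X, ∑ y : BIJ88PolymerRep5134Gauss.Site blk X, Real.exp (-(μ / 2 * d y'.1 y.1)) ≤ Z)
    (hlin : ∀ b ∈ B₀, IsLinearMap ℝ (Φ b)) {Λ : ℝ} (hΛ : 0 < Λ)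
    (hframe : ∀ (θ : ↥B₀ → ℝ) (φ : α → ℝ), |∑ b : ↥B₀, θ b * Φ b φ| ≤ Λ * Real.sqrt (∑ b : ↥B₀, θ b ^ 2) * Real.sqrt (φ ⬝ᵥ φ))
    {Λinf : ℝ} (hΦinf : ∀ b : ↥B₀, ∀ (φ : α → ℝ) (M : ℝ), 0 ≤ M → (∀ x, |φ x| ≤ M) → |Φ b φ| ≤ Λinf * M)
    {a : ↥B₀ → ℝ} (ha : ∀ b, 0 ≤ a b) {η : Type} (T : Finset η) (hit : η → Finset ↥B₀) {M : η → ℝ} (hM : ∀ t ∈ T, 0 ≤ M t)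
    {G : (BIJ88PolymerRep5134Gauss.Site blk X → ℝ) → ℝ}
    (hG : ∀ ω, |G ω| ≤ ∑ t ∈ T, M t *
      {ω : BIJ88PolymerRep5134Gauss.Site blk X → ℝ | ∀ b ∈ hit t, a b ≤ |Φ b (ext blk X ω)|}.indicator 1 ω) :
    |gexp (prec blk (interpForm blk Δ (corner ℝ Λc)) X s) (src blk ℱ X) G| ≤
      ∑ t ∈ T, M t * ∏ b ∈ hit t, 2 * Real.exp (-(a b * (a b - 2 * (Λinf * (2 / m * F₀ * Z))) / (2 * (Λ ^ 2 / m)))) := by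
  have hcs := corner_mem_cube (I := I) Λc
  exact abs_gexp_prec_le_sum_shell_local blk (interpForm blk Δ (corner ℝ Λc)) ℱ (interpForm_posDef blk hΔ hcs) hm
    (quadForm_interpForm_ge blk hΔm hcs) hs X hlin hΛ hframe (Dr := fun _ => Λinf * (2 / m * F₀ * Z))
    (fun b => abs_slotField_drift_le blk Δ ℱ d hd0 hdsymm hdtri hband hh0 hh hz hΔ hm hΔm hμ hsmall Λc X hs hF₀ hℱ hZ0 hZ (hΦinf b))
    ha T hit hM hG

end Literature.MathematicalPhysics.QuantumFieldTheory.BalabanImbrieJaffe1984to88.BIJ88SlotDriftLetter309
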